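import Literature.NumberTheory.LFunctions.MauduitRivatTypeIIMainTerms
import Literature.NumberTheory.LFunctions.MauduitRivatThreeRanges
import HarnessLib

/-!
# Mauduit–Rivat's type-II estimate for unitary matrices, step 6: the diagonal frequencies `h₀ + h₁ = 0` of `S₄` (§6.4.1 of Mauduit–Rivat 2015, (72)–(84); proved)

Everything in this file is PROVED (plus plain definitions). Starting from the Fourier expansion
`corrS4r_eq` of `S₄(r,s)` (`MauduitRivatTypeIIFourier.lean`), C. Mauduit, J. Rivat, J. Eur. Math.
Soc. 17 (2015), §6.4 split `S₄(r,s) = S₄'(r,s) + S₄''(r,s)` according to `h₀ + h₁ = 0` or not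
((72)). Here we treat the diagonal part `S₄'` (§6.4.1) for unitary-matrix weights (C. Müllner,
Duke Math. J. 166 (2017), §5.4.2), with explicit constants and WITHOUT any hypothesis on the relative
size of the two variables (the `m`- and `n`-sums factorise):

* `phaseNM`, `innerH`, `corrS4rDiag`, `corrS4rOff`, `corrS4r_eq_diag_add_off` — the splitting (72);
* `sum_range_comp_add_of_periodic` (and `_sub_`) — sums of a `K'`-periodic `g : ℤ → ℝ` over `K'`
  consecutive integers; `S7_neg` — `S₇(−h) = S₇(h)`; `sum_Ico_S7_le` — `∑_{a₀≤a<a₀+K'} S₇(a) ≤ d²` ((81));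
* `norm_innerH_diag_le` — for `h₀ + h₁ = 0`:
  `|∑_{h₂,h₃} tr(ĝ(h₃)ᴴĝ(h₁+h₃)ĝ(h₂)ᴴĝ(h₀+h₂)) Σ_{n,m} e(…)| ≤ min(M, 1/(2‖h₀r/k^{μ₂}‖)) · S₇(h₀) · ∑_{h<K'} min(N, 1/(2‖sh/k^{μ₂−μ₁}‖))`
  (geometric sums in `m` and `n`, `|tr(AB)| ≤ ‖A‖‖B‖`, `‖A‖‖B‖ ≤ (‖A‖² + ‖B‖²)/2` and periodicity —
  this is (73)–(74) with `S₆ ≤ S₇`);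
* **`sum_sum_norm_corrS4rDiag_le`** — (75)–(84): summing over `1 ≤ r < R`, `1 ≤ s < S` with Lemma 5
  for the `n`-kernels and the three-ranges lemma (`sum_three_ranges_le`, (76)–(83)) for the `h₁`-sum,
  `∑_r ∑_s |S₄'(r,s)| ≤ k^{μ₁−μ₀}(2Sτ(k^{μ₂−μ₁})N + S k^{μ₂−μ₁}(1 + log k^{μ₂−μ₁}))`
  `· (R M RS + (k^{μ₂}/T + k^{μ₀}) d² (1 + log R))`,
  where `RS` is any bound for the short sum `∑_{|a|≤T} S₇(a)` (supplied by Lemma 10 in the assembly).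

## References
* C. Mauduit, J. Rivat, J. Eur. Math. Soc. 17 (2015), §6.4.1 ((72)–(84)), (81), Lemma 5.
  [MauduitRivat2015]
* C. Müllner, Duke Math. J. 166 (2017) = arXiv:1602.03042, §5.4.2 (S₄', S₅–S₈). [Mullner2017]
-/

noncomputable section

open Finset Complex Matrix

open scoped FourierTransform InnerProductSpace ComplexConjugate Matrix.Norms.Frobenius

namespace Literature.NumberTheory.LFunctions.MauduitRivat

open Literature.NumberTheory.Sieve.Vinogradov (geomBound geomBound_nonneg geomBound_neg geomBound_le
  geomBound_zero geomBound_le_inv geomBound_mono distInt distInt_nonneg distInt_neg)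
open Literature.NumberTheory.LFunctions.VinogradovZetaSum (geomBound_add_int)

/-! ## Sums of periodic functions over a period -/

/-- A `P`-periodic `g : ℤ → M` has the same sum over `t + [0, P)` for every `t ∈ ℤ`. [folklore] -/
theorem sum_range_comp_add_of_periodic {M : Type*} [AddCommGroup M] {P : ℕ} {g : ℤ → M}
    (hg : ∀ z : ℤ, g (z + P) = g z) (t : ℤ) :
    ∑ h ∈ range P, g (t + h) = ∑ h ∈ range P, g h := by
  -- the function `t ↦ ∑_{h<P} g(t+h)` is invariant under `t ↦ t + 1`
  have step : ∀ t : ℤ, ∑ h ∈ range P, g (t + 1 + h) = ∑ h ∈ range P, g (t + h) := by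
    intro t
    rcases Nat.eq_zero_or_pos P with hP | hP
    · subst hP; simp
    obtain ⟨P', rfl⟩ : ∃ P', P = P' + 1 := ⟨P - 1, by omega⟩
    rw [sum_range_succ, sum_range_succ']
    have e1 : g (t + 1 + (P' : ℕ)) = g t := by
      have := hg t
      rw [← this]
      congr 1; push_cast; ring
    rw [e1]
    simp only [Nat.cast_add, Nat.cast_one, Nat.cast_zero, add_zero]
    congr 1
    exact sum_congr rfl fun h _ => by congr 1; ring
  induction t using Int.induction_on with
  | zero => simp
  | succ i ih => rw [step, ih]
  | pred i ih =>
    have := step (-(i : ℤ) - 1)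
    rw [show -(i : ℤ) - 1 + 1 = -(i : ℤ) by ring] at this
    rw [← ih, ← this]

/-- A `P`-periodic `g : ℤ → M` has the same sum over `t − [0, P)` for every `t ∈ ℤ`. [folklore] -/
theorem sum_range_comp_sub_of_periodic {M : Type*} [AddCommGroup M] {P : ℕ} {g : ℤ → M}
    (hg : ∀ z : ℤ, g (z + P) = g z) (t : ℤ) :
    ∑ h ∈ range P, g (t - h) = ∑ h ∈ range P, g h := by
  have h1 : ∑ h ∈ range P, g (t - h) = ∑ j ∈ range P, g (t - (P : ℤ) + 1 + j) := by
    rw [← sum_range_reflect (fun j : ℕ => g (t - (P : ℤ) + 1 + j)) P]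
    refine sum_congr rfl fun j hj => ?_
    have hj' := mem_range.1 hj
    congr 1
    rw [Nat.cast_sub (by omega), Nat.cast_sub (by omega)]
    push_cast; ring
  rw [h1, sum_range_comp_add_of_periodic hg]

/-! ## `S₇` is even and has bounded block sums -/

variable {d : Type*} [Fintype d] [DecidableEq d] {G : Type*} [Group G]

/-- `S₇` is `K'`-periodic in its argument. [folklore] -/
theorem S7_add_period (U : G →* unitaryGroup d ℂ) (f : ℕ → G) (k μ₀ μ₁ μ₂ : ℕ) (a : ℤ) :
    S7 U f k μ₀ μ₁ μ₂ (a + (k ^ (μ₂ - μ₀) : ℕ)) = S7 U f k μ₀ μ₁ μ₂ a := by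
  unfold S7
  refine sum_congr rfl fun x _ => ?_
  have e : (x : ℝ) + ((a + ((k ^ (μ₂ - μ₀) : ℕ) : ℤ) : ℤ) : ℝ) =
      ((x : ℝ) + (a : ℝ)) + ((k ^ (μ₂ - μ₀) : ℕ) : ℝ) * ((1 : ℤ) : ℝ) := by push_cast; ring
  rw [e, ghatR_add_period]

/-- **`S₇(−h) = S₇(h)`**: `‖ĝ(x)ᴴĝ(x−h)‖ = ‖ĝ(x−h)ᴴĝ(x)‖` and the shift `x ↦ x − h` permutes a period.
[cite: MauduitRivat2015, (74)] -/
theorem S7_neg (U : G →* unitaryGroup d ℂ) (f : ℕ → G) (k μ₀ μ₁ μ₂ : ℕ) (a : ℤ) :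
    S7 U f k μ₀ μ₁ μ₂ (-a) = S7 U f k μ₀ μ₁ μ₂ a := by
  set g : ℤ → ℝ := fun z => ‖(ghatR U f k μ₀ μ₁ μ₂ (z : ℝ))ᴴ * ghatR U f k μ₀ μ₁ μ₂ ((z : ℝ) + a)‖ ^ 2
    with hg
  have hper : ∀ z : ℤ, g (z + (k ^ (μ₂ - μ₀) : ℕ)) = g z := by
    intro z
    simp only [hg]
    have e1 : ((z + ((k ^ (μ₂ - μ₀) : ℕ) : ℤ) : ℤ) : ℝ) = (z : ℝ) + ((k ^ (μ₂ - μ₀) : ℕ) : ℝ) * ((1 : ℤ) : ℝ) := by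
      push_cast; ring
    have e2 : ((z + ((k ^ (μ₂ - μ₀) : ℕ) : ℤ) : ℤ) : ℝ) + (a : ℝ) =
        ((z : ℝ) + a) + ((k ^ (μ₂ - μ₀) : ℕ) : ℝ) * ((1 : ℤ) : ℝ) := by
      push_cast; ring
    rw [e2, e1, ghatR_add_period, ghatR_add_period]
  have hR : S7 U f k μ₀ μ₁ μ₂ a = ∑ x ∈ range (k ^ (μ₂ - μ₀)), g x := by
    unfold S7
    exact sum_congr rfl fun x _ => by simp [hg]
  have hL : S7 U f k μ₀ μ₁ μ₂ (-a) = ∑ x ∈ range (k ^ (μ₂ - μ₀)), g ((x : ℤ) - a) := by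
    unfold S7
    refine sum_congr rfl fun x _ => ?_
    simp only [hg]
    have e : (((x : ℤ) - a : ℤ) : ℝ) + a = (x : ℝ) := by push_cast; ring
    rw [e, show (x : ℝ) + ((-a : ℤ) : ℝ) = (((x : ℤ) - a : ℤ) : ℝ) by push_cast; ring]
    rw [← frobenius_norm_conjTranspose, conjTranspose_mul, conjTranspose_conjTranspose]
  rw [hL, hR]
  have := sum_range_comp_sub_of_periodic hper 0
  simp only [zero_sub] at this
  have h2 : ∑ x ∈ range (k ^ (μ₂ - μ₀)), g ((x : ℤ) - a) = ∑ x ∈ range (k ^ (μ₂ - μ₀)), g (-a + x) :=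
    sum_congr rfl fun x _ => by congr 1; ring
  rw [h2, sum_range_comp_add_of_periodic hper]

omit [DecidableEq d] in
/-- `∑_{a ∈ [a₀, a₀+n)} F(a) = ∑_{h<n} F(a₀ + h)` for integer intervals. [folklore] -/
theorem sum_Ico_int_eq_sum_range {M : Type*} [AddCommMonoid M] (F : ℤ → M) (a₀ : ℤ) (n : ℕ) :
    ∑ a ∈ Ico a₀ (a₀ + n), F a = ∑ h ∈ range n, F (a₀ + h) := by
  induction n with
  | zero => simp
  | succ n ih =>
    rw [sum_range_succ, ← ih, Nat.cast_succ, ← add_assoc,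
      ← Finset.insert_Ico_right_eq_Ico_add_one (by omega : a₀ ≤ a₀ + n), sum_insert (by simp),
      add_comm]

/-- **Block sums of `S₇`** ((81)): `∑_{a₀ ≤ a < a₀+K'} S₇(a) ≤ d²` for every `a₀ ∈ ℤ` (`k ≥ 1`).
[cite: MauduitRivat2015, (81)] -/
theorem sum_Ico_S7_le (U : G →* unitaryGroup d ℂ) (f : ℕ → G) {k : ℕ} (hk : 0 < k) (μ₀ μ₁ μ₂ : ℕ)
    (a₀ : ℤ) :
    ∑ a ∈ Ico a₀ (a₀ + (k ^ (μ₂ - μ₀) : ℕ)), S7 U f k μ₀ μ₁ μ₂ a ≤ (Fintype.card d : ℝ) ^ 2 := by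
  rw [sum_Ico_int_eq_sum_range, sum_range_comp_add_of_periodic (S7_add_period U f k μ₀ μ₁ μ₂)]
  exact sum_S7_le U f hk μ₀ μ₁ μ₂

/-! ## The splitting `S₄ = S₄' + S₄''` -/

/-- The `(n, m)` phase sum of the expansion `corrS4r_eq`:
`∑_n ∑_{m, m+sk^{μ₁}<M₁} e(((h₀+h₁)mn + h₁mr)/k^{μ₂}) e(s k^{μ₁−μ₀}((n+r)(h₁+h₃) − n h₂)/k^{μ₂−μ₀})`.
[cite: MauduitRivat2015, §6.3 (last display)] -/
def phaseNM (k μ₀ μ₁ μ₂ M₀ M₁ N₀ N₁ r s : ℕ) (h₀ h₁ : ℤ) (h₂ h₃ : ℕ) : ℂ :=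
  ∑ n ∈ Ico N₀ N₁, ∑ m ∈ (Ico M₀ M₁).filter (fun m => m + s * k ^ μ₁ < M₁),
    (𝐞 ((((h₀ : ℝ) + h₁) * m * n + (h₁ : ℝ) * m * r) / (k ^ μ₂ : ℕ)) : ℂ) *
      ((𝐞 (((s * k ^ (μ₁ - μ₀) * (n + r) : ℕ) : ℝ) * ((h₁ : ℝ) + h₃) / (k ^ (μ₂ - μ₀) : ℕ)) : ℂ) *
        (𝐞 (-(((s * k ^ (μ₁ - μ₀) * n : ℕ) : ℝ) * h₂ / (k ^ (μ₂ - μ₀) : ℕ))) : ℂ))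

/-- The `(h₂, h₃)`-sum of `corrS4r_eq` for a pair of frequencies `(h₀, h₁)`:
`∑_{h₂,h₃<K'} tr(ĝ(h₃)ᴴ ĝ(h₁+h₃) ĝ(h₂)ᴴ ĝ(h₀+h₂)) · phaseNM`. [cite: MauduitRivat2015, §6.3–6.4] -/
def innerH (U : G →* unitaryGroup d ℂ) (f : ℕ → G) (k μ₀ μ₁ μ₂ M₀ M₁ N₀ N₁ r s : ℕ) (h₀ h₁ : ℤ) : ℂ :=
  ∑ h₂ ∈ range (k ^ (μ₂ - μ₀)), ∑ h₃ ∈ range (k ^ (μ₂ - μ₀)),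
    trace ((ghatR U f k μ₀ μ₁ μ₂ (h₃ : ℝ))ᴴ * ghatR U f k μ₀ μ₁ μ₂ ((h₁ : ℝ) + h₃) *
        ((ghatR U f k μ₀ μ₁ μ₂ (h₂ : ℝ))ᴴ * ghatR U f k μ₀ μ₁ μ₂ ((h₀ : ℝ) + h₂))) *
      phaseNM k μ₀ μ₁ μ₂ M₀ M₁ N₀ N₁ r s h₀ h₁ h₂ h₃

/-- `corrS4r_eq` restated: `S₄(r,s) = K'² ∑_{h₀,h₁} â(h₀)â(h₁) · innerH(h₀,h₁)`.
[cite: MauduitRivat2015, §6.3] -/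
theorem corrS4r_eq_sum_innerH (U : G →* unitaryGroup d ℂ) (f : ℕ → G) {k : ℕ} (hk : 0 < k)
    {μ₀ μ₁ μ₂ : ℕ} (h01 : μ₀ ≤ μ₁) (h12 : μ₁ ≤ μ₂) (Hs M₀ M₁ N₀ N₁ r s : ℕ) :
    corrS4r U f k μ₀ μ₁ μ₂ Hs M₀ M₁ N₀ N₁ r s =
      (((k ^ (μ₂ - μ₀) : ℕ) : ℂ) * ((k ^ (μ₂ - μ₀) : ℕ) : ℂ)) *
        ∑ h₀ ∈ Ioo (-(Hs : ℤ)) Hs, ∑ h₁ ∈ Ioo (-(Hs : ℤ)) Hs,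
          ahat (k ^ μ₂) (k ^ μ₀) Hs h₀ * ahat (k ^ μ₂) (k ^ μ₀) Hs h₁ *
            innerH U f k μ₀ μ₁ μ₂ M₀ M₁ N₀ N₁ r s h₀ h₁ := by
  rw [corrS4r_eq U f hk h01 h12]
  rfl

/-- **`S₄'(r,s)`**, the contribution of the frequencies `h₀ + h₁ = 0` ((72)):
`K'² ∑_{h₀} â(h₀) â(−h₀) innerH(h₀, −h₀)`. [cite: MauduitRivat2015, (72)–(73)] -/
def corrS4rDiag (U : G →* unitaryGroup d ℂ) (f : ℕ → G) (k μ₀ μ₁ μ₂ Hs M₀ M₁ N₀ N₁ r s : ℕ) : ℂ :=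
  (((k ^ (μ₂ - μ₀) : ℕ) : ℂ) * ((k ^ (μ₂ - μ₀) : ℕ) : ℂ)) *
    ∑ h₀ ∈ Ioo (-(Hs : ℤ)) Hs,
      ahat (k ^ μ₂) (k ^ μ₀) Hs h₀ * ahat (k ^ μ₂) (k ^ μ₀) Hs (-h₀) *
        innerH U f k μ₀ μ₁ μ₂ M₀ M₁ N₀ N₁ r s h₀ (-h₀)

/-- **`S₄''(r,s)`**, the contribution of the frequencies `h₀ + h₁ ≠ 0` ((72)).
[cite: MauduitRivat2015, (72)] -/
def corrS4rOff (U : G →* unitaryGroup d ℂ) (f : ℕ → G) (k μ₀ μ₁ μ₂ Hs M₀ M₁ N₀ N₁ r s : ℕ) : ℂ :=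
  (((k ^ (μ₂ - μ₀) : ℕ) : ℂ) * ((k ^ (μ₂ - μ₀) : ℕ) : ℂ)) *
    ∑ h₀ ∈ Ioo (-(Hs : ℤ)) Hs, ∑ h₁ ∈ (Ioo (-(Hs : ℤ)) Hs).filter (fun h₁ => h₀ + h₁ ≠ 0),
      ahat (k ^ μ₂) (k ^ μ₀) Hs h₀ * ahat (k ^ μ₂) (k ^ μ₀) Hs h₁ *
        innerH U f k μ₀ μ₁ μ₂ M₀ M₁ N₀ N₁ r s h₀ h₁

/-- **(72): `S₄(r,s) = S₄'(r,s) + S₄''(r,s)`.** [cite: MauduitRivat2015, (72)] -/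
theorem corrS4r_eq_diag_add_off (U : G →* unitaryGroup d ℂ) (f : ℕ → G) {k : ℕ} (hk : 0 < k)
    {μ₀ μ₁ μ₂ : ℕ} (h01 : μ₀ ≤ μ₁) (h12 : μ₁ ≤ μ₂) (Hs M₀ M₁ N₀ N₁ r s : ℕ) :
    corrS4r U f k μ₀ μ₁ μ₂ Hs M₀ M₁ N₀ N₁ r s =
      corrS4rDiag U f k μ₀ μ₁ μ₂ Hs M₀ M₁ N₀ N₁ r s + corrS4rOff U f k μ₀ μ₁ μ₂ Hs M₀ M₁ N₀ N₁ r s := by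
  rw [corrS4r_eq_sum_innerH U f hk h01 h12, corrS4rDiag, corrS4rOff, ← mul_add, ← sum_add_distrib]
  congr 1
  refine sum_congr rfl fun h₀ hh₀ => ?_
  rw [← sum_filter_add_sum_filter_not (Ioo (-(Hs : ℤ)) Hs) (fun h₁ => h₀ + h₁ = 0)]
  congr 1
  · have hmem : -h₀ ∈ Ioo (-(Hs : ℤ)) Hs := by
      rw [mem_Ioo] at hh₀ ⊢; constructor <;> omega
    have hfilter : (Ioo (-(Hs : ℤ)) Hs).filter (fun h₁ => h₀ + h₁ = 0) = {-h₀} := by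
      ext h₁
      simp only [mem_filter, mem_singleton]
      constructor
      · rintro ⟨-, h⟩; omega
      · rintro rfl; exact ⟨hmem, by omega⟩
    rw [hfilter, sum_singleton]

/-! ## Geometric sums in `m` and `n` -/

/-- `‖∑_{a≤n<b} e(ny)‖ ≤ min(V, 1/(2‖y‖))` for `b − a ≤ V`. [folklore] -/
theorem norm_sum_Ico_fourierChar_le_geomBound' {a b : ℕ} {V : ℝ} (y : ℝ) (hV : ((b - a : ℕ) : ℝ) ≤ V) :
    ‖∑ n ∈ Ico a b, (𝐞 ((n : ℝ) * y) : ℂ)‖ ≤ geomBound V y := by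
  have hV0 : 0 ≤ V := le_trans (Nat.cast_nonneg _) hV
  have e : ∑ n ∈ Ico a b, (𝐞 ((n : ℝ) * y) : ℂ) =
      (𝐞 ((a : ℝ) * y) : ℂ) * ∑ j ∈ range (b - a), (𝐞 ((j : ℝ) * y) : ℂ) := by
    rw [sum_Ico_eq_sum_range, mul_sum]
    refine sum_congr rfl fun j _ => ?_
    rw [coe_fourierChar_mul]
    push_cast
    rw [add_mul]
  rw [e, norm_mul, norm_fourierChar, one_mul]
  exact (norm_sum_range_fourierChar_le_geomBound y le_rfl).trans (geomBound_mono hV y)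

/-- The `m`-range of `S₄(r,s)` is the interval `[M₀, M₁ − sk^{μ₁})`. [folklore] -/
theorem filter_add_lt_eq_Ico (M₀ M₁ L : ℕ) :
    (Ico M₀ M₁).filter (fun m => m + L < M₁) = Ico M₀ (M₁ - L) := by
  ext m
  simp only [mem_filter, mem_Ico]
  omega

/-- **The phase sum factorises on the diagonal**: for `h₁ = −h₀`,
`‖phaseNM‖ ≤ min(M₁−M₀, 1/(2‖h₀r/k^{μ₂}‖)) · min(N₁−N₀, 1/(2‖s(h₃−h₀−h₂)/k^{μ₂−μ₁}‖))`
(`μ₀ ≤ μ₁ ≤ μ₂`, `k ≥ 1`). [cite: MauduitRivat2015, §6.4.1 (first two displays)] -/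
theorem norm_phaseNM_diag_le {k : ℕ} (hk : 0 < k) {μ₀ μ₁ μ₂ : ℕ} (h01 : μ₀ ≤ μ₁) (h12 : μ₁ ≤ μ₂)
    (M₀ M₁ N₀ N₁ r s : ℕ) (h₀ : ℤ) (h₂ h₃ : ℕ) :
    ‖phaseNM k μ₀ μ₁ μ₂ M₀ M₁ N₀ N₁ r s h₀ (-h₀) h₂ h₃‖ ≤
      geomBound ((M₁ - M₀ : ℕ) : ℝ) ((h₀ : ℝ) * r / (k ^ μ₂ : ℕ)) *
        geomBound ((N₁ - N₀ : ℕ) : ℝ) ((s : ℝ) * (((h₃ : ℤ) - h₀ - h₂ : ℤ) : ℝ) / (k ^ (μ₂ - μ₁) : ℕ)) := by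
  have hK : (0 : ℝ) < (k ^ μ₂ : ℕ) := by positivity
  have hK' : (0 : ℝ) < (k ^ (μ₂ - μ₀) : ℕ) := by positivity
  -- the phases
  set A : ℕ → ℂ := fun m => (𝐞 ((m : ℝ) * (-((h₀ : ℝ) * r / (k ^ μ₂ : ℕ)))) : ℂ) with hA
  set y : ℝ := (s : ℝ) * (((h₃ : ℤ) - h₀ - h₂ : ℤ) : ℝ) / (k ^ (μ₂ - μ₁) : ℕ) with hy
  set c₀ : ℂ := (𝐞 (((s * k ^ (μ₁ - μ₀) * r : ℕ) : ℝ) * (-(h₀ : ℝ) + h₃) / (k ^ (μ₂ - μ₀) : ℕ)) : ℂ)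
    with hc₀
  set B : ℕ → ℂ := fun n => c₀ * (𝐞 ((n : ℝ) * y) : ℂ) with hB
  have hpow : ((k ^ (μ₂ - μ₀) : ℕ) : ℝ) = (k ^ (μ₂ - μ₁) : ℕ) * (k ^ (μ₁ - μ₀) : ℕ) := by
    rw [← Nat.cast_mul, ← pow_add]
    congr 2; omega
  have hterm : ∀ n m : ℕ,
      (𝐞 ((((h₀ : ℝ) + ((-h₀ : ℤ) : ℝ)) * m * n + ((-h₀ : ℤ) : ℝ) * m * r) / (k ^ μ₂ : ℕ)) : ℂ) *
        ((𝐞 (((s * k ^ (μ₁ - μ₀) * (n + r) : ℕ) : ℝ) * (((-h₀ : ℤ) : ℝ) + h₃) / (k ^ (μ₂ - μ₀) : ℕ)) : ℂ) *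
          (𝐞 (-(((s * k ^ (μ₁ - μ₀) * n : ℕ) : ℝ) * h₂ / (k ^ (μ₂ - μ₀) : ℕ))) : ℂ)) = A m * B n := by
    intro n m
    simp only [hA, hB, hc₀, hy, coe_fourierChar_mul]
    congr 2
    have hK'ne : ((k ^ (μ₂ - μ₀) : ℕ) : ℝ) ≠ 0 := hK'.ne'
    have hP : ((k ^ (μ₂ - μ₁) : ℕ) : ℝ) ≠ 0 := by positivity
    rw [hpow] at hK'ne ⊢
    push_cast
    field_simp
    ring
  have hphase : phaseNM k μ₀ μ₁ μ₂ M₀ M₁ N₀ N₁ r s h₀ (-h₀) h₂ h₃ =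
      (∑ n ∈ Ico N₀ N₁, B n) * ∑ m ∈ Ico M₀ (M₁ - s * k ^ μ₁), A m := by
    rw [phaseNM, filter_add_lt_eq_Ico, sum_mul]
    refine sum_congr rfl fun n _ => ?_
    rw [mul_sum]
    exact sum_congr rfl fun m _ => by rw [hterm n m, mul_comm]
  rw [hphase, norm_mul, mul_comm]
  refine mul_le_mul ?_ ?_ (norm_nonneg _) (geomBound_nonneg (Nat.cast_nonneg _) _)
  · -- the `m`-sum
    simp only [hA]
    rw [← geomBound_neg]
    refine norm_sum_Ico_fourierChar_le_geomBound' _ ?_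
    exact_mod_cast (show M₁ - s * k ^ μ₁ - M₀ ≤ M₁ - M₀ by omega)
  · -- the `n`-sum
    simp only [hB]
    rw [← mul_sum, norm_mul, hc₀, norm_fourierChar, one_mul]
    exact norm_sum_Ico_fourierChar_le_geomBound' _ le_rfl

/-! ## The diagonal `(h₂, h₃)`-sum: `S₆ ≤ S₇` -/

/-- The `n`-kernel `min(N, 1/(2‖s y/k^{μ₂−μ₁}‖))` as a function of `y ∈ ℤ`. [cite: MauduitRivat2015, §6.4.1] -/
def nKernel (k μ₁ μ₂ N s : ℕ) (y : ℤ) : ℝ :=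
  geomBound (N : ℝ) ((s : ℝ) * (y : ℝ) / (k ^ (μ₂ - μ₁) : ℕ))

omit [DecidableEq d] in
/-- The `n`-kernel is `k^{μ₂−μ₀}`-periodic (indeed `k^{μ₂−μ₁}`-periodic) for `μ₁ ≤ μ₂`. [folklore] -/
theorem nKernel_add_period {k : ℕ} (hk : 0 < k) {μ₀ μ₁ μ₂ : ℕ} (h01 : μ₀ ≤ μ₁) (h12 : μ₁ ≤ μ₂)
    (N s : ℕ) (y : ℤ) :
    nKernel k μ₁ μ₂ N s (y + (k ^ (μ₂ - μ₀) : ℕ)) = nKernel k μ₁ μ₂ N s y := by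
  unfold nKernel
  have hk0 : (k : ℝ) ≠ 0 := by exact_mod_cast hk.ne'
  have hpow : (k : ℝ) ^ (μ₂ - μ₀) = (k : ℝ) ^ (μ₂ - μ₁) * (k : ℝ) ^ (μ₁ - μ₀) := by
    rw [← pow_add]; congr 1; omega
  have e : (s : ℝ) * (((y + ((k ^ (μ₂ - μ₀) : ℕ) : ℤ) : ℤ) : ℝ)) / (k ^ (μ₂ - μ₁) : ℕ) =
      (s : ℝ) * (y : ℝ) / (k ^ (μ₂ - μ₁) : ℕ) + (((s * k ^ (μ₁ - μ₀) : ℕ) : ℤ) : ℝ) := by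
    push_cast
    rw [hpow]
    field_simp
  rw [e, geomBound_add_int]

omit [DecidableEq d] in
/-- `0 ≤ nKernel`. [folklore] -/
theorem nKernel_nonneg (k μ₁ μ₂ N s : ℕ) (y : ℤ) : 0 ≤ nKernel k μ₁ μ₂ N s y :=
  geomBound_nonneg (Nat.cast_nonneg N) _

/-- **`S₆ ≤ S₇` on the diagonal** ((73)–(74), matrix form): for `h₁ = −h₀`,
`‖innerH(h₀, −h₀)‖ ≤ min(M₁−M₀, 1/(2‖h₀r/k^{μ₂}‖)) · S₇(h₀) · ∑_{h<k^{μ₂−μ₀}} min(N₁−N₀, 1/(2‖sh/k^{μ₂−μ₁}‖))`: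
bound the traces by `‖ĝ(h₃)ᴴĝ(h₃−h₀)‖ ‖ĝ(h₂)ᴴĝ(h₂+h₀)‖ ≤ (‖·‖² + ‖·‖²)/2`, the phases by
`norm_phaseNM_diag_le`, and use the periodicity of the `n`-kernel in `h₂` (resp. `h₃`) and `S₇(−h₀) = S₇(h₀)`.
[cite: MauduitRivat2015, (73)–(74)] [cite: Mullner2017, §5.4.2 (S₆ ≤ S₇)] -/
theorem norm_innerH_diag_le (U : G →* unitaryGroup d ℂ) (f : ℕ → G) {k : ℕ} (hk : 0 < k)
    {μ₀ μ₁ μ₂ : ℕ} (h01 : μ₀ ≤ μ₁) (h12 : μ₁ ≤ μ₂) (M₀ M₁ N₀ N₁ r s : ℕ) (h₀ : ℤ) :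
    ‖innerH U f k μ₀ μ₁ μ₂ M₀ M₁ N₀ N₁ r s h₀ (-h₀)‖ ≤
      geomBound ((M₁ - M₀ : ℕ) : ℝ) ((h₀ : ℝ) * r / (k ^ μ₂ : ℕ)) * S7 U f k μ₀ μ₁ μ₂ h₀ *
        ∑ h ∈ range (k ^ (μ₂ - μ₀)), nKernel k μ₁ μ₂ (N₁ - N₀) s h := by
  set K' := k ^ (μ₂ - μ₀) with hK'
  set Gm : ℝ := geomBound ((M₁ - M₀ : ℕ) : ℝ) ((h₀ : ℝ) * r / (k ^ μ₂ : ℕ)) with hGm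
  set Gn : ℤ → ℝ := nKernel k μ₁ μ₂ (N₁ - N₀) s with hGn
  set A : ℕ → Matrix d d ℂ := fun h₃ =>
    (ghatR U f k μ₀ μ₁ μ₂ (h₃ : ℝ))ᴴ * ghatR U f k μ₀ μ₁ μ₂ (((-h₀ : ℤ) : ℝ) + h₃) with hA
  set B : ℕ → Matrix d d ℂ := fun h₂ =>
    (ghatR U f k μ₀ μ₁ μ₂ (h₂ : ℝ))ᴴ * ghatR U f k μ₀ μ₁ μ₂ ((h₀ : ℝ) + h₂) with hB
  have hGm0 : 0 ≤ Gm := geomBound_nonneg (Nat.cast_nonneg _) _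
  have hGn0 : ∀ y, 0 ≤ Gn y := fun y => nKernel_nonneg _ _ _ _ _ _
  have hGnper : ∀ y : ℤ, Gn (y + (K' : ℕ)) = Gn y := fun y => nKernel_add_period hk h01 h12 _ _ y
  set SG : ℝ := ∑ h ∈ range K', Gn h with hSG
  -- (1) termwise bound
  have h1 : ‖innerH U f k μ₀ μ₁ μ₂ M₀ M₁ N₀ N₁ r s h₀ (-h₀)‖ ≤
      ∑ h₂ ∈ range K', ∑ h₃ ∈ range K', (‖A h₃‖ * ‖B h₂‖) * (Gm * Gn ((h₃ : ℤ) - h₀ - h₂)) := by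
    rw [innerH]
    refine (norm_sum_le _ _).trans (sum_le_sum fun h₂ _ => (norm_sum_le _ _).trans
      (sum_le_sum fun h₃ _ => ?_))
    rw [norm_mul]
    refine mul_le_mul ?_ ?_ (norm_nonneg _) (by positivity)
    · exact norm_trace_mul_le (A h₃) (B h₂)
    · exact norm_phaseNM_diag_le hk h01 h12 M₀ M₁ N₀ N₁ r s h₀ h₂ h₃
  -- (2) `ab ≤ (a² + b²)/2`
  have h2 : ∑ h₂ ∈ range K', ∑ h₃ ∈ range K', (‖A h₃‖ * ‖B h₂‖) * (Gm * Gn ((h₃ : ℤ) - h₀ - h₂)) ≤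
      Gm / 2 * (∑ h₂ ∈ range K', ∑ h₃ ∈ range K', ‖A h₃‖ ^ 2 * Gn ((h₃ : ℤ) - h₀ - h₂) +
        ∑ h₂ ∈ range K', ∑ h₃ ∈ range K', ‖B h₂‖ ^ 2 * Gn ((h₃ : ℤ) - h₀ - h₂)) := by
    rw [← sum_add_distrib, mul_sum]
    refine sum_le_sum fun h₂ _ => ?_
    rw [← sum_add_distrib, mul_sum]
    refine sum_le_sum fun h₃ _ => ?_
    have hab : ‖A h₃‖ * ‖B h₂‖ ≤ (‖A h₃‖ ^ 2 + ‖B h₂‖ ^ 2) / 2 := by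
      have := two_mul_le_add_sq ‖A h₃‖ ‖B h₂‖; linarith
    calc ‖A h₃‖ * ‖B h₂‖ * (Gm * Gn ((h₃ : ℤ) - h₀ - h₂))
        ≤ (‖A h₃‖ ^ 2 + ‖B h₂‖ ^ 2) / 2 * (Gm * Gn ((h₃ : ℤ) - h₀ - h₂)) :=
          mul_le_mul_of_nonneg_right hab (mul_nonneg hGm0 (hGn0 _))
      _ = _ := by ring
  -- (3) the kernel sums are full periods
  have h3A : ∑ h₂ ∈ range K', ∑ h₃ ∈ range K', ‖A h₃‖ ^ 2 * Gn ((h₃ : ℤ) - h₀ - h₂) =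
      (∑ h₃ ∈ range K', ‖A h₃‖ ^ 2) * SG := by
    rw [sum_comm, sum_mul]
    refine sum_congr rfl fun h₃ _ => ?_
    rw [← mul_sum]
    congr 1
    have := sum_range_comp_sub_of_periodic hGnper ((h₃ : ℤ) - h₀)
    rw [hSG, ← this]
  have h3B : ∑ h₂ ∈ range K', ∑ h₃ ∈ range K', ‖B h₂‖ ^ 2 * Gn ((h₃ : ℤ) - h₀ - h₂) =
      (∑ h₂ ∈ range K', ‖B h₂‖ ^ 2) * SG := by
    rw [sum_mul]
    refine sum_congr rfl fun h₂ _ => ?_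
    rw [← mul_sum]
    congr 1
    have := sum_range_comp_add_of_periodic hGnper (-h₀ - (h₂ : ℤ))
    rw [hSG, ← this]
    exact sum_congr rfl fun h₃ _ => by congr 1; ring
  -- (4) identify `S₇`
  have h4A : ∑ h₃ ∈ range K', ‖A h₃‖ ^ 2 = S7 U f k μ₀ μ₁ μ₂ h₀ := by
    rw [← S7_neg U f k μ₀ μ₁ μ₂ h₀, S7]
    refine sum_congr rfl fun x _ => ?_
    simp only [hA]
    rw [add_comm]
  have h4B : ∑ h₂ ∈ range K', ‖B h₂‖ ^ 2 = S7 U f k μ₀ μ₁ μ₂ h₀ := by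
    rw [S7]
    refine sum_congr rfl fun x _ => ?_
    simp only [hB]
    rw [add_comm]
  calc ‖innerH U f k μ₀ μ₁ μ₂ M₀ M₁ N₀ N₁ r s h₀ (-h₀)‖
      ≤ Gm / 2 * ((∑ h₃ ∈ range K', ‖A h₃‖ ^ 2) * SG + (∑ h₂ ∈ range K', ‖B h₂‖ ^ 2) * SG) := by
        rw [← h3A, ← h3B]; exact h1.trans h2
    _ = Gm * S7 U f k μ₀ μ₁ μ₂ h₀ * SG := by rw [h4A, h4B]; ring
    _ = _ := by rw [hSG]

/-! ## The weights of the `h₀`-sum and `S₄'(r,s)` termwise -/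

/-- The weight `K'² |â(a)| |â(−a)| min(M₁−M₀, 1/(2‖ar/k^{μ₂}‖))` of `S₇(a)` in `|S₄'(r,s)|`
(`K' = k^{μ₂−μ₀}`; this is the summand of `S₈(r)` in (75)). [cite: MauduitRivat2015, (75)] -/
def diagWeight (k μ₀ μ₂ Hs M₀ M₁ r : ℕ) (a : ℤ) : ℝ :=
  (((k ^ (μ₂ - μ₀) : ℕ) : ℝ) * (k ^ (μ₂ - μ₀) : ℕ)) *
    (‖ahat (k ^ μ₂) (k ^ μ₀) Hs a‖ * ‖ahat (k ^ μ₂) (k ^ μ₀) Hs (-a)‖) *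
      geomBound ((M₁ - M₀ : ℕ) : ℝ) ((a : ℝ) * r / (k ^ μ₂ : ℕ))

omit [DecidableEq d] in
/-- `diagWeight ≥ 0`. [folklore] -/
theorem diagWeight_nonneg (k μ₀ μ₂ Hs M₀ M₁ r : ℕ) (a : ℤ) : 0 ≤ diagWeight k μ₀ μ₂ Hs M₀ M₁ r a := by
  unfold diagWeight
  have := geomBound_nonneg (Nat.cast_nonneg (M₁ - M₀)) ((a : ℝ) * r / (k ^ μ₂ : ℕ))
  positivity

/-- **`|S₄'(r,s)| ≤ (∑_{h<K'} min(N, 1/(2‖sh/k^{μ₂−μ₁}‖))) · ∑_{h₀} diagWeight(h₀) S₇(h₀)`** ((73)–(75)).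
[cite: MauduitRivat2015, (73)–(75)] -/
theorem norm_corrS4rDiag_le (U : G →* unitaryGroup d ℂ) (f : ℕ → G) {k : ℕ} (hk : 0 < k)
    {μ₀ μ₁ μ₂ : ℕ} (h01 : μ₀ ≤ μ₁) (h12 : μ₁ ≤ μ₂) (Hs M₀ M₁ N₀ N₁ r s : ℕ) :
    ‖corrS4rDiag U f k μ₀ μ₁ μ₂ Hs M₀ M₁ N₀ N₁ r s‖ ≤
      (∑ h ∈ range (k ^ (μ₂ - μ₀)), nKernel k μ₁ μ₂ (N₁ - N₀) s h) *
        ∑ h₀ ∈ Ioo (-(Hs : ℤ)) Hs, diagWeight k μ₀ μ₂ Hs M₀ M₁ r h₀ * S7 U f k μ₀ μ₁ μ₂ h₀ := by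
  set SG := ∑ h ∈ range (k ^ (μ₂ - μ₀)), nKernel k μ₁ μ₂ (N₁ - N₀) s h with hSG
  have hSG0 : 0 ≤ SG := sum_nonneg fun h _ => nKernel_nonneg _ _ _ _ _ _
  rw [corrS4rDiag, norm_mul, norm_mul, Complex.norm_natCast, mul_sum]
  calc (((k ^ (μ₂ - μ₀) : ℕ) : ℝ) * ((k ^ (μ₂ - μ₀) : ℕ) : ℝ)) *
        ‖∑ h₀ ∈ Ioo (-(Hs : ℤ)) Hs, ahat (k ^ μ₂) (k ^ μ₀) Hs h₀ * ahat (k ^ μ₂) (k ^ μ₀) Hs (-h₀) *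
          innerH U f k μ₀ μ₁ μ₂ M₀ M₁ N₀ N₁ r s h₀ (-h₀)‖
      ≤ (((k ^ (μ₂ - μ₀) : ℕ) : ℝ) * ((k ^ (μ₂ - μ₀) : ℕ) : ℝ)) *
          ∑ h₀ ∈ Ioo (-(Hs : ℤ)) Hs, ‖ahat (k ^ μ₂) (k ^ μ₀) Hs h₀‖ * ‖ahat (k ^ μ₂) (k ^ μ₀) Hs (-h₀)‖ *
            (geomBound ((M₁ - M₀ : ℕ) : ℝ) ((h₀ : ℝ) * r / (k ^ μ₂ : ℕ)) * S7 U f k μ₀ μ₁ μ₂ h₀ * SG) := by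
        refine mul_le_mul_of_nonneg_left ((norm_sum_le _ _).trans (sum_le_sum fun h₀ _ => ?_))
          (by positivity)
        rw [norm_mul, norm_mul]
        exact mul_le_mul_of_nonneg_left (norm_innerH_diag_le U f hk h01 h12 M₀ M₁ N₀ N₁ r s h₀)
          (by positivity)
    _ = ∑ h₀ ∈ Ioo (-(Hs : ℤ)) Hs, SG * (diagWeight k μ₀ μ₂ Hs M₀ M₁ r h₀ * S7 U f k μ₀ μ₁ μ₂ h₀) := by
        rw [mul_sum]
        refine sum_congr rfl fun h₀ _ => ?_
        rw [diagWeight]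
        ring

/-! ## The three ranges of `h₀` -/

/-- `min(V, 1/(2‖x‖)) ≤ K/(2n)` when `|x| = n/K` with `0 < 2n ≤ K`. [folklore] -/
theorem geomBound_le_div_of_abs_eq {K n : ℕ} (hn : 0 < n) (h2 : 2 * n ≤ K) (V : ℝ) {x : ℝ}
    (hx : |x| = (n : ℝ) / K) : geomBound V x ≤ (K : ℝ) / (2 * n) := by
  have hK : 0 < K := by omega
  have hKR : (0 : ℝ) < K := by exact_mod_cast hK
  have hnR : (0 : ℝ) < n := by exact_mod_cast hn
  have hd : (n : ℝ) / K ≤ distInt x := by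
    have h1 : distInt x = distInt |x| := by
      rcases abs_choice x with h | h
      · rw [h]
      · rw [h, distInt_neg]
    have h2' : min (n : ℝ) ((K : ℝ) - n) / K ≤ distInt ((n : ℝ) / K) := min_div_le_distInt hK (by omega)
    have hmin : min (n : ℝ) ((K : ℝ) - n) = n := by
      apply min_eq_left
      have : ((2 * n : ℕ) : ℝ) ≤ K := by exact_mod_cast h2
      push_cast at this; linarith
    rw [hmin] at h2'
    rw [h1, hx]; exact h2'
  have hdpos : 0 < distInt x := lt_of_lt_of_le (by positivity) hd
  calc geomBound V x ≤ 1 / (2 * distInt x) := geomBound_le_inv V hdpos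
    _ ≤ 1 / (2 * ((n : ℝ) / K)) := by
        apply one_div_le_one_div_of_le (by positivity); linarith
    _ = (K : ℝ) / (2 * n) := by field_simp

/-- `|a r / K| = (|a| r)/K` as a natural-number numerator. [folklore] -/
theorem abs_int_mul_div_eq (a : ℤ) (r K : ℕ) :
    |(a : ℝ) * r / K| = ((a.natAbs * r : ℕ) : ℝ) / K := by
  rw [abs_div, abs_mul, Nat.abs_cast, Nat.abs_cast, Nat.cast_mul, Nat.cast_natAbs, Int.cast_abs]

/-- `‖â(a)‖ ≤ L/K` (`K ≥ 1`). [cite: MauduitRivat2015, (15)] -/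
theorem norm_ahat_le_div {K : ℕ} (hK : 0 < K) (L H : ℕ) (a : ℤ) :
    ‖ahat K L H a‖ ≤ (L : ℝ) / K := by
  calc ‖ahat K L H a‖ ≤ (K : ℝ)⁻¹ * geomBound L ((a : ℝ) / K) := norm_ahat_le hK L H a
    _ ≤ (K : ℝ)⁻¹ * L := mul_le_mul_of_nonneg_left (geomBound_le _ _) (by positivity)
    _ = (L : ℝ) / K := by rw [inv_mul_eq_div]

/-- `‖â(a)‖ ≤ 1/(2|a|)` for `0 < 2|a| ≤ K`. [cite: MauduitRivat2015, (15)] -/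
theorem norm_ahat_le_inv_abs {K : ℕ} (L H : ℕ) {a : ℤ} (ha : a ≠ 0) (h2 : 2 * a.natAbs ≤ K) :
    ‖ahat K L H a‖ ≤ 1 / (2 * |(a : ℝ)|) := by
  have hn : 0 < a.natAbs := Int.natAbs_pos.2 ha
  have hK : 0 < K := by omega
  have hKR : (0 : ℝ) < K := by exact_mod_cast hK
  have habs : |(a : ℝ) / K| = ((a.natAbs * 1 : ℕ) : ℝ) / K := by
    have := abs_int_mul_div_eq a 1 K
    simpa using this
  have hg := geomBound_le_div_of_abs_eq (K := K) (n := a.natAbs * 1) (by simpa using hn) (by simpa using h2)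
    (L : ℝ) habs
  have hcast : ((a.natAbs * 1 : ℕ) : ℝ) = |(a : ℝ)| := by
    rw [mul_one, Nat.cast_natAbs, Int.cast_abs]
  rw [hcast] at hg
  have hapos : 0 < |(a : ℝ)| := abs_pos.2 (by exact_mod_cast ha)
  calc ‖ahat K L H a‖ ≤ (K : ℝ)⁻¹ * geomBound L ((a : ℝ) / K) := norm_ahat_le hK L H a
    _ ≤ (K : ℝ)⁻¹ * ((K : ℝ) / (2 * |(a : ℝ)|)) := mul_le_mul_of_nonneg_left hg (by positivity)
    _ = 1 / (2 * |(a : ℝ)|) := by field_simp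

/-- **The three estimates (80), (82), (83) assembled**: for `1 ≤ r`, `2 Hs r ≤ k^{μ₂}`, `T ≥ 1`
and any bound `RS` of the short sum `∑_{|a|≤T} S₇(a)`,
`∑_{|h₀|<Hs} diagWeight(h₀) S₇(h₀) ≤ (M₁−M₀) RS + k^{μ₂} d²/(T r) + k^{μ₂} d²/(k^{μ₂−μ₀} r)`.
[cite: MauduitRivat2015, (76), (80), (82), (83)] -/
theorem sum_diagWeight_mul_S7_le (U : G →* unitaryGroup d ℂ) (f : ℕ → G) {k : ℕ} (hk : 0 < k)
    {μ₀ μ₂ : ℕ} (h02 : μ₀ ≤ μ₂) (μ₁ : ℕ) {Hs r T : ℕ} (hr : 1 ≤ r) (hHr : 2 * Hs * r ≤ k ^ μ₂)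
    (hT : 1 ≤ T) (M₀ M₁ : ℕ) {RS : ℝ} (hRS : ∑ a ∈ Icc (-(T : ℤ)) T, S7 U f k μ₀ μ₁ μ₂ a ≤ RS) :
    ∑ h₀ ∈ Ioo (-(Hs : ℤ)) Hs, diagWeight k μ₀ μ₂ Hs M₀ M₁ r h₀ * S7 U f k μ₀ μ₁ μ₂ h₀ ≤
      ((M₁ - M₀ : ℕ) : ℝ) * RS + (k ^ μ₂ : ℕ) * (Fintype.card d : ℝ) ^ 2 / (T * r) +
        (k ^ μ₂ : ℕ) * (Fintype.card d : ℝ) ^ 2 / ((k ^ (μ₂ - μ₀) : ℕ) * r) := by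
  have hKL : k ^ μ₂ = k ^ (μ₂ - μ₀) * k ^ μ₀ := by rw [← pow_add, Nat.sub_add_cancel h02]
  have hK0 : 0 < k ^ μ₂ := by positivity
  have hK'0 : 0 < k ^ (μ₂ - μ₀) := by positivity
  have hL0 : 0 < k ^ μ₀ := by positivity
  have hKR : (0 : ℝ) < (k ^ μ₂ : ℕ) := by exact_mod_cast hK0
  have hK'R : (0 : ℝ) < (k ^ (μ₂ - μ₀) : ℕ) := by exact_mod_cast hK'0
  have hLR : (0 : ℝ) < (k ^ μ₀ : ℕ) := by exact_mod_cast hL0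
  have hKLR : ((k ^ μ₂ : ℕ) : ℝ) = (k ^ (μ₂ - μ₀) : ℕ) * (k ^ μ₀ : ℕ) := by exact_mod_cast hKL
  set M' : ℝ := ((M₁ - M₀ : ℕ) : ℝ) with hM'
  have hM'0 : 0 ≤ M' := Nat.cast_nonneg _
  -- the truncated weight
  set W : ℤ → ℝ := fun a => if a.natAbs < Hs then diagWeight k μ₀ μ₂ Hs M₀ M₁ r a else 0 with hW
  have hW0 : ∀ a, 0 ≤ W a := by
    intro a; simp only [hW]; split_ifs
    · exact diagWeight_nonneg _ _ _ _ _ _ _ _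
    · exact le_rfl
  -- monotonicity of the weight in its three factors
  have hmono : ∀ (a : ℤ) {b₁ b₂ c : ℝ},
      ‖ahat (k ^ μ₂) (k ^ μ₀) Hs a‖ ≤ b₁ → ‖ahat (k ^ μ₂) (k ^ μ₀) Hs (-a)‖ ≤ b₂ →
      geomBound M' ((a : ℝ) * r / (k ^ μ₂ : ℕ)) ≤ c →
      diagWeight k μ₀ μ₂ Hs M₀ M₁ r a ≤
        (((k ^ (μ₂ - μ₀) : ℕ) : ℝ) * (k ^ (μ₂ - μ₀) : ℕ)) * (b₁ * b₂) * c := by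
    intro a b₁ b₂ c h1 h2 h3
    rw [diagWeight]
    have hn1 := norm_nonneg (ahat (k ^ μ₂) (k ^ μ₀) Hs a)
    have hn2 := norm_nonneg (ahat (k ^ μ₂) (k ^ μ₀) Hs (-a))
    have hg0 : 0 ≤ geomBound M' ((a : ℝ) * r / (k ^ μ₂ : ℕ)) := geomBound_nonneg hM'0 _
    have h12 : ‖ahat (k ^ μ₂) (k ^ μ₀) Hs a‖ * ‖ahat (k ^ μ₂) (k ^ μ₀) Hs (-a)‖ ≤ b₁ * b₂ :=
      mul_le_mul h1 h2 hn2 (hn1.trans h1)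
    refine mul_le_mul (mul_le_mul_of_nonneg_left h12 (by positivity)) h3 hg0 ?_
    exact mul_nonneg (by positivity) ((mul_nonneg hn1 hn2).trans h12)
  -- bounds for `|a| < Hs`
  have hahat1 : ∀ a : ℤ, ‖ahat (k ^ μ₂) (k ^ μ₀) Hs a‖ ≤ ((k ^ μ₀ : ℕ) : ℝ) / (k ^ μ₂ : ℕ) :=
    fun a => norm_ahat_le_div hK0 _ Hs a
  have hsmall : ∀ a : ℤ, a.natAbs < Hs → 2 * a.natAbs ≤ k ^ μ₂ := by
    intro a ha
    calc 2 * a.natAbs ≤ 2 * Hs * 1 := by omega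
      _ ≤ 2 * Hs * r := Nat.mul_le_mul_left _ hr
      _ ≤ k ^ μ₂ := hHr
  have hGm : ∀ a : ℤ, a ≠ 0 → a.natAbs < Hs →
      geomBound M' ((a : ℝ) * r / (k ^ μ₂ : ℕ)) ≤ ((k ^ μ₂ : ℕ) : ℝ) / (2 * |(a : ℝ)| * r) := by
    intro a ha haH
    have hn : 0 < a.natAbs * r := Nat.mul_pos (Int.natAbs_pos.2 ha) hr
    have h2 : 2 * (a.natAbs * r) ≤ k ^ μ₂ := by
      calc 2 * (a.natAbs * r) = 2 * a.natAbs * r := by ring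
        _ ≤ 2 * Hs * r := Nat.mul_le_mul_right _ (by omega)
        _ ≤ k ^ μ₂ := hHr
    have hg := geomBound_le_div_of_abs_eq hn h2 M' (abs_int_mul_div_eq a r (k ^ μ₂))
    refine hg.trans (le_of_eq ?_)
    rw [Nat.cast_mul, Nat.cast_natAbs, Int.cast_abs]
    ring
  -- (hW1)
  have hW1 : ∀ a, W a ≤ M' := by
    intro a
    simp only [hW]
    split_ifs with ha
    · refine (hmono a (hahat1 a) (hahat1 (-a)) (geomBound_le _ _)).trans (le_of_eq ?_)
      rw [hKLR]
      field_simp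
    · exact hM'0
  -- (hW2)
  have hW2 : ∀ a : ℤ, a ≠ 0 → W a ≤ ((k ^ μ₂ : ℕ) : ℝ) / (2 * |(a : ℝ)| * r) := by
    intro a ha
    have hapos : 0 < |(a : ℝ)| := abs_pos.2 (by exact_mod_cast ha)
    simp only [hW]
    split_ifs with haH
    · refine (hmono a (hahat1 a) (hahat1 (-a)) (hGm a ha haH)).trans (le_of_eq ?_)
      rw [hKLR]
      field_simp
    · positivity
  -- (hW3)
  have hW3 : ∀ a : ℤ, ((k ^ (μ₂ - μ₀) : ℕ) : ℤ) ≤ |a| →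
      W a ≤ (((k ^ (μ₂ - μ₀) : ℕ) : ℝ) / (2 * |(a : ℝ)|)) ^ 2 * (((k ^ μ₂ : ℕ) : ℝ) / (2 * |(a : ℝ)| * r)) := by
    intro a haK
    have ha : a ≠ 0 := by
      intro h
      rw [h, abs_zero] at haK
      have : (0 : ℤ) < ((k ^ (μ₂ - μ₀) : ℕ) : ℤ) := by exact_mod_cast hK'0
      omega
    have hapos : 0 < |(a : ℝ)| := abs_pos.2 (by exact_mod_cast ha)
    simp only [hW]
    split_ifs with haH
    · have hna : ‖ahat (k ^ μ₂) (k ^ μ₀) Hs a‖ ≤ 1 / (2 * |(a : ℝ)|) :=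
        norm_ahat_le_inv_abs _ Hs ha (hsmall a haH)
      have hna' : ‖ahat (k ^ μ₂) (k ^ μ₀) Hs (-a)‖ ≤ 1 / (2 * |(a : ℝ)|) := by
        have h := norm_ahat_le_inv_abs (K := k ^ μ₂) (k ^ μ₀) Hs (neg_ne_zero.2 ha)
          (by rw [Int.natAbs_neg]; exact hsmall a haH)
        rwa [Int.cast_neg, abs_neg] at h
      refine (hmono a hna hna' (hGm a ha haH)).trans (le_of_eq ?_)
      ring
    · positivity
  -- block and short sums of `S₇`
  have hRB : ∀ a₀ : ℤ, ∑ a ∈ Ico a₀ (a₀ + (k ^ (μ₂ - μ₀) : ℕ)), S7 U f k μ₀ μ₁ μ₂ a ≤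
      (Fintype.card d : ℝ) ^ 2 :=
    fun a₀ => sum_Ico_S7_le U f hk μ₀ μ₁ μ₂ a₀
  have h3 := sum_three_ranges_le (H := Hs) hK'0 hT hr hKR.le hM'0 W
    (S7 U f k μ₀ μ₁ μ₂) hW0 (S7_nonneg U f k μ₀ μ₁ μ₂) hW1 hW2 hW3 hRB hRS
  -- on `(−Hs, Hs)` the truncation is invisible
  have hsame : ∑ h₀ ∈ Ioo (-(Hs : ℤ)) Hs, diagWeight k μ₀ μ₂ Hs M₀ M₁ r h₀ * S7 U f k μ₀ μ₁ μ₂ h₀ =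
      ∑ h₀ ∈ Ioo (-(Hs : ℤ)) Hs, W h₀ * S7 U f k μ₀ μ₁ μ₂ h₀ := by
    refine sum_congr rfl fun a ha => ?_
    rw [mem_Ioo] at ha
    have : a.natAbs < Hs := by omega
    simp only [hW, if_pos this]
  rw [hsame]
  exact h3

/-! ## Summing over `r` and `s` -/

/-- **The `n`-kernels summed over `s` and a period** ((75) with (22) = Lemma 5):
`∑_{1≤s<S} ∑_{h<k^{μ₂−μ₀}} min(N, 1/(2‖sh/k^{μ₂−μ₁}‖)) ≤ k^{μ₁−μ₀}(2(S−1)τ(k^{μ₂−μ₁})N + (S−1)k^{μ₂−μ₁}(1 + log k^{μ₂−μ₁}))`.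
[cite: MauduitRivat2015, (75) and Lemma 5] -/
theorem sum_sum_nKernel_le {k : ℕ} (hk : 0 < k) {μ₀ μ₁ μ₂ : ℕ} (h01 : μ₀ ≤ μ₁) (h12 : μ₁ ≤ μ₂)
    (N S : ℕ) :
    ∑ s ∈ Ico 1 S, ∑ h ∈ range (k ^ (μ₂ - μ₀)), nKernel k μ₁ μ₂ N s h ≤
      ((k ^ (μ₁ - μ₀) : ℕ) : ℝ) * (2 * ((S - 1 : ℕ) : ℝ) * ((k ^ (μ₂ - μ₁)).divisors.card : ℝ) * N +
        ((S - 1 : ℕ) : ℝ) * ((k ^ (μ₂ - μ₁) : ℕ) * (1 + Real.log ((k ^ (μ₂ - μ₁) : ℕ) : ℝ)))) := by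
  have hP0 : 0 < k ^ (μ₂ - μ₁) := by positivity
  have hPR : (0 : ℝ) < (k ^ (μ₂ - μ₁) : ℕ) := by exact_mod_cast hP0
  have hKP : k ^ (μ₂ - μ₀) = k ^ (μ₂ - μ₁) * k ^ (μ₁ - μ₀) := by
    rw [← pow_add]; congr 1; omega
  -- one period in `h`
  have hper : ∀ s h : ℕ, nKernel k μ₁ μ₂ N s ((h + k ^ (μ₂ - μ₁) : ℕ) : ℤ) = nKernel k μ₁ μ₂ N s h := by
    intro s h
    unfold nKernel
    have e : (s : ℝ) * (((h + k ^ (μ₂ - μ₁) : ℕ) : ℤ) : ℝ) / (k ^ (μ₂ - μ₁) : ℕ) =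
        (s : ℝ) * (((h : ℕ) : ℤ) : ℝ) / (k ^ (μ₂ - μ₁) : ℕ) + ((s : ℤ) : ℝ) := by
      push_cast; field_simp
    rw [e, geomBound_add_int]
  have hsplit : ∀ s : ℕ, ∑ h ∈ range (k ^ (μ₂ - μ₀)), nKernel k μ₁ μ₂ N s h =
      (k ^ (μ₁ - μ₀) : ℕ) * ∑ h ∈ range (k ^ (μ₂ - μ₁)), nKernel k μ₁ μ₂ N s h := by
    intro s
    rw [hKP]
    exact sum_range_mul_of_periodic (P := k ^ (μ₂ - μ₁)) (g := k ^ (μ₁ - μ₀))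
      (h := fun h : ℕ => nKernel k μ₁ μ₂ N s h) (hper s)
  have hL5 := sum_sum_geomBound_progression_le hP0 (S - 1) 0 (Nat.cast_nonneg N)
  have hIcc : Icc 1 (S - 1) = Ico 1 S := by ext s; simp only [mem_Icc, mem_Ico]; omega
  rw [hIcc] at hL5
  have hinner : ∀ s : ℕ, ∑ h ∈ range (k ^ (μ₂ - μ₁)), nKernel k μ₁ μ₂ N s h =
      ∑ h ∈ range (k ^ (μ₂ - μ₁)), geomBound (N : ℝ) (((s : ℝ) * h + 0) / (k ^ (μ₂ - μ₁) : ℕ)) := by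
    intro s
    refine sum_congr rfl fun h _ => ?_
    rw [nKernel, add_zero, Int.cast_natCast]
  calc ∑ s ∈ Ico 1 S, ∑ h ∈ range (k ^ (μ₂ - μ₀)), nKernel k μ₁ μ₂ N s h
      = (k ^ (μ₁ - μ₀) : ℕ) * ∑ s ∈ Ico 1 S, ∑ h ∈ range (k ^ (μ₂ - μ₁)),
          geomBound (N : ℝ) (((s : ℝ) * h + 0) / (k ^ (μ₂ - μ₁) : ℕ)) := by
        rw [mul_sum]
        exact sum_congr rfl fun s _ => by rw [hsplit, hinner]
    _ ≤ (k ^ (μ₁ - μ₀) : ℕ) * (2 * ((S - 1 : ℕ) : ℝ) * ((k ^ (μ₂ - μ₁)).divisors.card : ℝ) * N +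
          ((S - 1 : ℕ) : ℝ) * ((k ^ (μ₂ - μ₁) : ℕ) * (1 + Real.log ((k ^ (μ₂ - μ₁) : ℕ) : ℝ)))) :=
        mul_le_mul_of_nonneg_left hL5 (Nat.cast_nonneg _)

/-- `∑_{1≤r<R} 1/r ≤ 1 + log R`. [folklore] -/
theorem sum_Ico_inv_le_log (R : ℕ) : ∑ r ∈ Ico 1 R, (r : ℝ)⁻¹ ≤ 1 + Real.log R := by
  rcases Nat.lt_or_ge R 2 with hR | hR
  · have hempty : ∑ r ∈ Ico 1 R, (r : ℝ)⁻¹ ≤ 0 := by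
      interval_cases R <;> simp
    have hlog : 0 ≤ Real.log R := by
      interval_cases R <;> simp
    linarith
  have hIco : Ico 1 R = Icc 1 (R - 1) := by ext r; simp only [mem_Ico, mem_Icc]; omega
  rw [hIco]
  have h := harmonic_le_one_add_log (R - 1)
  rw [harmonic_eq_sum_Icc] at h
  push_cast at h
  have hlog : Real.log ((R - 1 : ℕ) : ℝ) ≤ Real.log R :=
    Real.log_le_log (by exact_mod_cast (show 0 < R - 1 by omega)) (by exact_mod_cast Nat.sub_le R 1)
  have hcast : ((R - 1 : ℕ) : ℝ) = (R : ℝ) - 1 := by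
    rw [Nat.cast_sub (by omega)]; simp
  rw [hcast] at h hlog
  linarith

/-- **§6.4.1 assembled: the diagonal part of `S₄` summed over `r` and `s`** ((75)–(84), matrix form,
explicit constants, no hypothesis on the relative size of `M` and `N`): for `μ₀ ≤ μ₁ ≤ μ₂`,
`2·Hs·R ≤ k^{μ₂}`, `T ≥ 1` and any bound `RS` of `∑_{|a| ≤ T} S₇(a)` (Lemma 10),
`∑_{1≤r<R} ∑_{1≤s<S} |S₄'(r,s)| ≤ k^{μ₁−μ₀}(2(S−1)τ(k^{μ₂−μ₁})(N₁−N₀) + (S−1)k^{μ₂−μ₁}(1 + log k^{μ₂−μ₁}))`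
`· (R(M₁−M₀)RS + (k^{μ₂}/T + k^{μ₀}) d² (1 + log R))`. [cite: MauduitRivat2015, (84)] -/
theorem sum_sum_norm_corrS4rDiag_le (U : G →* unitaryGroup d ℂ) (f : ℕ → G) {k : ℕ} (hk : 0 < k)
    {μ₀ μ₁ μ₂ : ℕ} (h01 : μ₀ ≤ μ₁) (h12 : μ₁ ≤ μ₂) {Hs R S T : ℕ} (hHR : 2 * Hs * R ≤ k ^ μ₂)
    (hT : 1 ≤ T) (M₀ M₁ N₀ N₁ : ℕ) {RS : ℝ}
    (hRS : ∑ a ∈ Icc (-(T : ℤ)) T, S7 U f k μ₀ μ₁ μ₂ a ≤ RS) :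
    ∑ r ∈ Ico 1 R, ∑ s ∈ Ico 1 S, ‖corrS4rDiag U f k μ₀ μ₁ μ₂ Hs M₀ M₁ N₀ N₁ r s‖ ≤
      ((k ^ (μ₁ - μ₀) : ℕ) : ℝ) * (2 * ((S - 1 : ℕ) : ℝ) * ((k ^ (μ₂ - μ₁)).divisors.card : ℝ) * ((N₁ - N₀ : ℕ) : ℝ) +
          ((S - 1 : ℕ) : ℝ) * ((k ^ (μ₂ - μ₁) : ℕ) * (1 + Real.log ((k ^ (μ₂ - μ₁) : ℕ) : ℝ)))) *
        (R * ((M₁ - M₀ : ℕ) : ℝ) * RS +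
          (((k ^ μ₂ : ℕ) : ℝ) / T + (k ^ μ₀ : ℕ)) * (Fintype.card d : ℝ) ^ 2 * (1 + Real.log R)) := by
  have h02 : μ₀ ≤ μ₂ := h01.trans h12
  have hK'0 : 0 < k ^ (μ₂ - μ₀) := by positivity
  have hK'R : (0 : ℝ) < (k ^ (μ₂ - μ₀) : ℕ) := by exact_mod_cast hK'0
  have hTR : (0 : ℝ) < T := by exact_mod_cast hT
  have hKL : ((k ^ μ₂ : ℕ) : ℝ) = (k ^ (μ₂ - μ₀) : ℕ) * (k ^ μ₀ : ℕ) := by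
    rw [← Nat.cast_mul, ← pow_add, Nat.sub_add_cancel h02]
  set M' : ℝ := ((M₁ - M₀ : ℕ) : ℝ) with hM'
  set D2 : ℝ := (Fintype.card d : ℝ) ^ 2 with hD2
  have hRS0 : 0 ≤ RS := le_trans (sum_nonneg fun a _ => S7_nonneg U f k μ₀ μ₁ μ₂ a) hRS
  -- the `n`-kernel factor and the `h₀`-sums
  set SG : ℕ → ℝ := fun s => ∑ h ∈ range (k ^ (μ₂ - μ₀)), nKernel k μ₁ μ₂ (N₁ - N₀) s h with hSG
  set X : ℕ → ℝ := fun r => ∑ h₀ ∈ Ioo (-(Hs : ℤ)) Hs,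
    diagWeight k μ₀ μ₂ Hs M₀ M₁ r h₀ * S7 U f k μ₀ μ₁ μ₂ h₀ with hX
  have hSG0 : ∀ s, 0 ≤ SG s := fun s => sum_nonneg fun h _ => nKernel_nonneg _ _ _ _ _ _
  have hX0 : ∀ r, 0 ≤ X r := fun r => sum_nonneg fun h₀ _ =>
    mul_nonneg (diagWeight_nonneg _ _ _ _ _ _ _ _) (S7_nonneg _ _ _ _ _ _ _)
  set NS : ℝ := ((k ^ (μ₁ - μ₀) : ℕ) : ℝ) * (2 * ((S - 1 : ℕ) : ℝ) * ((k ^ (μ₂ - μ₁)).divisors.card : ℝ) *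
      ((N₁ - N₀ : ℕ) : ℝ) + ((S - 1 : ℕ) : ℝ) * ((k ^ (μ₂ - μ₁) : ℕ) * (1 + Real.log ((k ^ (μ₂ - μ₁) : ℕ) : ℝ))))
    with hNS
  have hNSle : ∑ s ∈ Ico 1 S, SG s ≤ NS := sum_sum_nKernel_le hk h01 h12 (N₁ - N₀) S
  have hY : ∀ r ∈ Ico 1 R, X r ≤ M' * RS + (k ^ μ₂ : ℕ) * D2 / (T * r) +
      (k ^ μ₂ : ℕ) * D2 / ((k ^ (μ₂ - μ₀) : ℕ) * r) := by
    intro r hr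
    rw [mem_Ico] at hr
    have hHr : 2 * Hs * r ≤ k ^ μ₂ := le_trans (Nat.mul_le_mul_left _ hr.2.le) hHR
    exact sum_diagWeight_mul_S7_le U f hk h02 μ₁ hr.1 hHr hT M₀ M₁ hRS
  -- termwise
  have h1 : ∑ r ∈ Ico 1 R, ∑ s ∈ Ico 1 S, ‖corrS4rDiag U f k μ₀ μ₁ μ₂ Hs M₀ M₁ N₀ N₁ r s‖ ≤
      ∑ r ∈ Ico 1 R, ∑ s ∈ Ico 1 S, SG s * X r :=
    sum_le_sum fun r _ => sum_le_sum fun s _ => norm_corrS4rDiag_le U f hk h01 h12 Hs M₀ M₁ N₀ N₁ r s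
  refine h1.trans ?_
  -- factorise and bound each factor
  have h2 : ∑ r ∈ Ico 1 R, ∑ s ∈ Ico 1 S, SG s * X r = (∑ s ∈ Ico 1 S, SG s) * ∑ r ∈ Ico 1 R, X r := by
    rw [sum_mul_sum, sum_comm]
  rw [h2]
  have hsumX : ∑ r ∈ Ico 1 R, X r ≤ R * M' * RS +
      (((k ^ μ₂ : ℕ) : ℝ) / T + (k ^ μ₀ : ℕ)) * D2 * (1 + Real.log R) := by
    calc ∑ r ∈ Ico 1 R, X r
        ≤ ∑ r ∈ Ico 1 R, (M' * RS + (k ^ μ₂ : ℕ) * D2 / (T * r) + (k ^ μ₂ : ℕ) * D2 / ((k ^ (μ₂ - μ₀) : ℕ) * r)) :=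
          sum_le_sum hY
      _ = ((R - 1 : ℕ) : ℝ) * (M' * RS) +
            ((k ^ μ₂ : ℕ) * D2 / T + (k ^ μ₂ : ℕ) * D2 / (k ^ (μ₂ - μ₀) : ℕ)) * ∑ r ∈ Ico 1 R, (r : ℝ)⁻¹ := by
          rw [sum_add_distrib, sum_add_distrib, sum_const, Nat.card_Ico, nsmul_eq_mul, mul_sum, add_assoc,
            ← sum_add_distrib]
          congr 1
          refine sum_congr rfl fun r hr => ?_
          have hr0 : (0 : ℝ) < r := by exact_mod_cast (mem_Ico.1 hr).1
          field_simp
      _ ≤ R * (M' * RS) + ((k ^ μ₂ : ℕ) * D2 / T + (k ^ μ₂ : ℕ) * D2 / (k ^ (μ₂ - μ₀) : ℕ)) * (1 + Real.log R) := by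
          gcongr
          · exact Nat.sub_le R 1
          · exact sum_Ico_inv_le_log R
      _ = R * M' * RS + (((k ^ μ₂ : ℕ) : ℝ) / T + (k ^ μ₀ : ℕ)) * D2 * (1 + Real.log R) := by
          rw [hKL]
          field_simp
  exact mul_le_mul hNSle hsumX (sum_nonneg fun r _ => hX0 r) ((sum_nonneg fun s _ => hSG0 s).trans hNSle)

end Literature.NumberTheory.LFunctions.MauduitRivat
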